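import Mathlib.Analysis.Complex.CauchyIntegral
import Mathlib.Analysis.Complex.UpperHalfPlane.Topology
import Mathlib.Analysis.SpecialFunctions.PolarCoord
import Mathlib.Analysis.SpecialFunctions.Integrals.Basic
import Mathlib.Analysis.Calculus.FDeriv.Measurable
import Mathlib.Analysis.Calculus.ContDiff.Deriv
import Mathlib.Analysis.InnerProductSpace.Calculus
import Mathlib.MeasureTheory.Function.Jacobian
import Mathlib.MeasureTheory.Integral.MeanInequalities
import Mathlib.MeasureTheory.Group.Measure
import Mathlib.MeasureTheory.Group.LIntegral
import Mathlib.MeasureTheory.Measure.Haar.Unique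
import Literature.Analysis.Complex.LengthArea
import HarnessLib

/-!
# Semicircles crossing an annulus under a conformal map: a length–area inequality

Topic: complex analysis (the length–area method behind extremal length). Everything here is
proved; the statements are the quantitative core of the proof of Lemma 6.2 of

* G. F. Lawler, O. Schramm, W. Werner, *Conformal restriction: the chordal case*, J. Amer. Math.
  Soc. **16** (2003) 917–955, arXiv:math/0209343, Lemma 6.2 (p. 23 of the arXiv version),

whose printed proof reads "The extremal length from `A'` to the circle `|z| = r` goes to infinity
with `r`. By monotonicity and conformal invariance of extremal length, the extremal length in `ℍ`
between `Ã` and `(-∞, W]` goes to infinity as well. Because `Ã` is connected, this implies that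
`diam(Ã) / inf{|W - z| : z ∈ Ã}` goes to zero." We replace the appeal to the general theory of
extremal length (Ahlfors, *Conformal Invariants*, Ch. 4) by the underlying length–area
computation (Pommerenke, *Boundary Behaviour of Conformal Maps* (1992), Prop. 2.2;
Garnett–Marshall, *Harmonic Measure* (2005), §IV.3) for two explicit one-parameter families of
semicircles.

Let `f` be holomorphic and injective on the open upper half-plane `ℍ` and `0 < R₁ < R₂`. A curve
in `ℍ` whose image passes from `{|z| < R₁}` to `{|z| > R₂}` has length at least `log (R₂/R₁)`
for the pulled-back metric `ρ = |f'| / |f| · 1{R₁ < |f| < R₂}` (`ofReal_log_le_mul_logAngLen`, the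
fundamental theorem of calculus for `log |f ∘ c|`), while the `ρ`-area of `ℍ` is at most the
`|dz|²/|z|²`-area `2π log (R₂/R₁)` of the annulus (`lintegral_densSq_le`, the area formula for
injective differentiable maps, Mathlib's `lintegral_image_eq_lintegral_abs_det_fderiv_mul`;
Pommerenke (1992), proof of Prop. 2.2, display (6), in the logarithmic metric).
Cauchy–Schwarz on the semicircles `{|w - c| = u} ∩ ℍ` and Fubini in polar coordinates about the
real centre `c` then give:

* `Literature.Analysis.Complex.AnnulusCrossing.lintegral_inv_le_of_forall_crossing` — if for
  every `u` in a measurable set `S ⊆ (0, ∞)` the semicircle of radius `u` about `c` is mapped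
  by `f` onto a curve crossing the annulus `{R₁ < |z| < R₂}`, then
  `∫_S du/u ≤ 2π² / log (R₂/R₁)`: **a conformal map can make a family of concentric semicircles
  all cross a fixed annulus of large modulus only if the family is logarithmically thin**;
* `Literature.Analysis.Complex.AnnulusCrossing.mul_log_le_of_forall_crossing_or` — the
  two-family form used for [LSW] Lemma 6.2: if `0 < m < p` and for every `u ∈ (m/2, m)` either
  the semicircle of radius `u` about `p`, or the semicircle of radius `p - u` about `0`, is
  mapped onto a curve crossing an annulus of logarithmic width `L`, then
  `L · log 2 · m ≤ 2π² (m + 2p)`; so `m/p → 0` as `L → ∞`.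

The semicircles are Mathlib's `circleMap (c : ℂ) u θ`, `θ ∈ (0, π)`; the angular integrals are
called `logAngLen`, `logAngSq` (logarithmic metric on `ℍ`) to distinguish them from the
`angLen`, `angSq` of `LengthArea` (metric `|f'|` on the disc). Only the values of `f` on `ℍ`
matter (no measurability of `f` off `ℍ` is assumed).

## References

* Ch. Pommerenke, *Boundary Behaviour of Conformal Maps*, Springer (1992), Prop. 2.2.
* J. B. Garnett, D. E. Marshall, *Harmonic Measure*, CUP (2005), §IV.3 (extremal length).
* L. V. Ahlfors, *Conformal Invariants*, McGraw-Hill (1973), Ch. 4.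
* G. F. Lawler, O. Schramm, W. Werner, *Conformal restriction: the chordal case*, J. Amer. Math.
  Soc. **16** (2003), Lemma 6.2. [LawlerSchrammWerner2003Restriction]
-/

noncomputable section

open Set Filter Metric Topology MeasureTheory Complex Real
open UpperHalfPlane (upperHalfPlaneSet isOpen_upperHalfPlaneSet)
open scoped ENNReal NNReal

namespace Literature.Analysis.Complex

namespace AnnulusCrossing

/-! ### Semicircles about a real centre: Mathlib's `circleMap` -/

/-- The imaginary part of `circleMap c u θ` for a real centre `c`. [folklore] -/
theorem circleMap_ofReal_im (c u θ : ℝ) : (circleMap (c : ℂ) u θ).im = u * Real.sin θ := by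
  simp [circleMap, Complex.exp_ofReal_mul_I_im, Complex.exp_ofReal_mul_I_re]

/-- For `u > 0` and `θ ∈ (0, π)` the point `c + u e^{iθ}` of the circle about the real centre
`c` lies in the open upper half-plane. [folklore] -/
theorem circleMap_mem_upperHalfPlaneSet (c : ℝ) {u θ : ℝ} (hu : 0 < u) (hθ : θ ∈ Ioo 0 π) :
    circleMap (c : ℂ) u θ ∈ upperHalfPlaneSet := by
  show 0 < (circleMap (c : ℂ) u θ).im
  rw [circleMap_ofReal_im]
  exact mul_pos hu (Real.sin_pos_of_pos_of_lt_pi hθ.1 hθ.2)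

/-- `circleMap c u θ` is Mathlib's inverse polar coordinates translated by `c`. [folklore] -/
theorem add_polarCoord_symm (c : ℂ) (q : ℝ × ℝ) :
    c + Complex.polarCoord.symm q = circleMap c q.1 q.2 := by
  rw [circleMap, Complex.polarCoord_symm_apply, Complex.exp_mul_I, ← ofReal_cos, ← ofReal_sin]

/-- `(u, θ) ↦ circleMap c u θ` is continuous. [folklore] -/
theorem continuous_circleMap_uncurry (c : ℂ) : Continuous fun q : ℝ × ℝ ↦ circleMap c q.1 q.2 := by
  unfold circleMap; fun_prop

/-- `u ↦ circleMap c u θ` is continuous. [folklore] -/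
theorem continuous_circleMap_left (c : ℂ) (θ : ℝ) : Continuous fun u : ℝ ↦ circleMap c u θ := by
  unfold circleMap; fun_prop

/-- The speed of `θ ↦ circleMap c u θ` is `|u|`. [folklore] -/
theorem norm_circleMap_zero_mul_I (u θ : ℝ) : ‖circleMap 0 u θ * I‖ = |u| := by
  rw [norm_mul, norm_I, mul_one, norm_circleMap_zero]

/-! ### The pulled-back logarithmic metric -/

variable {f : ℂ → ℂ} {R₁ R₂ : ℝ}

/-- The open set `{w ∈ ℍ : R₁ < |f w| < R₂}` on which the pulled-back metric lives. [folklore] -/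
def preAnn (f : ℂ → ℂ) (R₁ R₂ : ℝ) : Set ℂ :=
  {w ∈ upperHalfPlaneSet | R₁ < ‖f w‖ ∧ ‖f w‖ < R₂}

/-- `preAnn` is open when `f` is continuous on `ℍ`. [folklore] -/
theorem isOpen_preAnn (hf : ContinuousOn f upperHalfPlaneSet) (R₁ R₂ : ℝ) :
    IsOpen (preAnn f R₁ R₂) := by
  have h := hf.norm.isOpen_inter_preimage isOpen_upperHalfPlaneSet (isOpen_Ioo (a := R₁) (b := R₂))
  exact h

/-- `preAnn` is measurable. [folklore] -/
theorem measurableSet_preAnn (hf : ContinuousOn f upperHalfPlaneSet) (R₁ R₂ : ℝ) :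
    MeasurableSet (preAnn f R₁ R₂) :=
  (isOpen_preAnn hf R₁ R₂).measurableSet

/-- The pulled-back metric `ρ = |f'|/|f|` on `preAnn f R₁ R₂`, zero elsewhere, `ℝ≥0∞`-valued.
[folklore] -/
def dens (f : ℂ → ℂ) (R₁ R₂ : ℝ) : ℂ → ℝ≥0∞ :=
  (preAnn f R₁ R₂).indicator fun w ↦ ENNReal.ofReal (‖deriv f w‖ / ‖f w‖)

/-- The square `ρ² = |f'|²/|f|²` of the pulled-back metric. [folklore] -/
def densSq (f : ℂ → ℂ) (R₁ R₂ : ℝ) : ℂ → ℝ≥0∞ :=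
  (preAnn f R₁ R₂).indicator fun w ↦ ENNReal.ofReal ((‖deriv f w‖ / ‖f w‖) ^ 2)

/-- `dens ^ 2 = densSq` pointwise. [folklore] -/
theorem dens_sq (f : ℂ → ℂ) (R₁ R₂ : ℝ) (w : ℂ) : dens f R₁ R₂ w ^ 2 = densSq f R₁ R₂ w := by
  by_cases hw : w ∈ preAnn f R₁ R₂
  · simp [dens, densSq, hw, ENNReal.ofReal_pow (div_nonneg (norm_nonneg _) (norm_nonneg _))]
  · simp [dens, densSq, hw]

/-- `dens` is measurable: on `preAnn ⊆ ℍ` the integrand only involves `f` on `ℍ`, where it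
is continuous (replace `f` by the measurable `ℍ.piecewise f 0`, Mathlib's
`ContinuousOn.measurable_piecewise`; `deriv f` is always measurable). [folklore] -/
theorem measurable_dens (hf : ContinuousOn f upperHalfPlaneSet) (R₁ R₂ : ℝ) :
    Measurable (dens f R₁ R₂) := by
  classical
  have hf0 : Measurable (upperHalfPlaneSet.piecewise f 0) :=
    hf.measurable_piecewise continuousOn_const isOpen_upperHalfPlaneSet.measurableSet
  have heq : dens f R₁ R₂ = (preAnn f R₁ R₂).indicator
      fun w ↦ ENNReal.ofReal (‖deriv f w‖ / ‖upperHalfPlaneSet.piecewise f 0 w‖) := by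
    funext w
    by_cases hw : w ∈ preAnn f R₁ R₂
    · rw [dens, indicator_of_mem hw, indicator_of_mem hw, piecewise_eq_of_mem _ _ _ hw.1]
    · rw [dens, indicator_of_notMem hw, indicator_of_notMem hw]
  rw [heq]
  exact (((measurable_deriv f).norm.div hf0.norm).ennreal_ofReal).indicator
    (measurableSet_preAnn hf R₁ R₂)

/-- `densSq` is measurable. [folklore] -/
theorem measurable_densSq (hf : ContinuousOn f upperHalfPlaneSet) (R₁ R₂ : ℝ) :
    Measurable (densSq f R₁ R₂) := by
  have h : densSq f R₁ R₂ = fun w ↦ dens f R₁ R₂ w ^ 2 := funext fun w ↦ (dens_sq f R₁ R₂ w).symm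
  rw [h]
  exact (measurable_dens hf R₁ R₂).pow_const 2

/-- The `ρ`-length density of the upper semicircle of radius `u` about `c` (without the factor
`u`): `∫_0^π ρ(c + u e^{iθ}) dθ`. [folklore] -/
def logAngLen (f : ℂ → ℂ) (R₁ R₂ c u : ℝ) : ℝ≥0∞ :=
  ∫⁻ θ in Ioo 0 π, dens f R₁ R₂ (circleMap (c : ℂ) u θ)

/-- `∫_0^π ρ(c + u e^{iθ})² dθ`. [folklore] -/
def logAngSq (f : ℂ → ℂ) (R₁ R₂ c u : ℝ) : ℝ≥0∞ :=
  ∫⁻ θ in Ioo 0 π, densSq f R₁ R₂ (circleMap (c : ℂ) u θ)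

/-- **Cauchy–Schwarz** on a semicircle: `(∫_0^π ρ dθ)² ≤ π ∫_0^π ρ² dθ`. [folklore] -/
theorem logAngLen_sq_le (hf : ContinuousOn f upperHalfPlaneSet) (R₁ R₂ c u : ℝ) :
    logAngLen f R₁ R₂ c u ^ 2 ≤ ENNReal.ofReal π * logAngSq f R₁ R₂ c u := by
  set μ : Measure ℝ := volume.restrict (Ioo 0 π) with hμ
  have hmeas : AEMeasurable (fun θ ↦ dens f R₁ R₂ (circleMap (c : ℂ) u θ)) μ :=
    ((measurable_dens hf R₁ R₂).comp (continuous_circleMap (c : ℂ) u).measurable).aemeasurable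
  have h := ENNReal.lintegral_mul_le_Lp_mul_Lq μ Real.HolderConjugate.two_two hmeas
    (g := fun _ ↦ 1) aemeasurable_const
  simp only [Pi.mul_apply, mul_one, lintegral_const, ENNReal.rpow_two, one_pow, one_mul] at h
  have hvol : μ univ = ENNReal.ofReal π := by
    rw [hμ, Measure.restrict_apply_univ, Real.volume_Ioo, sub_zero]
  rw [hvol] at h
  have hsq : ∫⁻ a, dens f R₁ R₂ (circleMap (c : ℂ) u a) ^ 2 ∂μ = logAngSq f R₁ R₂ c u := by
    simp only [dens_sq]; rfl
  rw [hsq] at h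
  calc logAngLen f R₁ R₂ c u ^ 2 = (∫⁻ a, dens f R₁ R₂ (circleMap (c : ℂ) u a) ∂μ) ^ 2 := rfl
    _ ≤ (logAngSq f R₁ R₂ c u ^ (1 / 2 : ℝ) * ENNReal.ofReal π ^ (1 / 2 : ℝ)) ^ 2 := by
      gcongr
    _ = ENNReal.ofReal π * logAngSq f R₁ R₂ c u := by
      rw [← ENNReal.mul_rpow_of_nonneg _ _ (by norm_num : (0 : ℝ) ≤ 1 / 2), ← ENNReal.rpow_two,
        ← ENNReal.rpow_mul]
      norm_num [mul_comm]

/-! ### Crossings of an interval of values by a continuous function -/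

/-- An increasing crossing: if `φ` is continuous on `[a, b]` with `φ a < R₁ < R₂ < φ b`, there is
a subinterval `[α, β]` on whose interior `R₁ < φ < R₂`, with `φ α = R₁` and `φ β = R₂` (take
`α` the last time `φ ≤ R₁` and `β` the first time after `α` with `φ ≥ R₂`). [folklore] -/
theorem exists_Ioo_crossing_of_lt {φ : ℝ → ℝ} {a b R₁ R₂ : ℝ} (hab : a ≤ b)
    (hφ : ContinuousOn φ (Icc a b)) (ha : φ a < R₁) (hb : R₂ < φ b) (hR : R₁ < R₂) :
    ∃ α β, a ≤ α ∧ α < β ∧ β ≤ b ∧ φ α = R₁ ∧ φ β = R₂ ∧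
      ∀ θ ∈ Ioo α β, R₁ < φ θ ∧ φ θ < R₂ := by
  -- `α`: the last time `φ ≤ R₁`
  set S : Set ℝ := Icc a b ∩ φ ⁻¹' Iic R₁ with hS
  have hSc : IsCompact S :=
    isCompact_Icc.of_isClosed_subset (hφ.preimage_isClosed_of_isClosed isClosed_Icc isClosed_Iic)
      inter_subset_left
  have haS : a ∈ S := ⟨left_mem_Icc.2 hab, ha.le⟩
  set α := sSup S with hαdef
  have hαS : α ∈ S := hSc.sSup_mem ⟨a, haS⟩
  have hαab : α ∈ Icc a b := hαS.1
  have hgt : ∀ θ ∈ Icc a b, α < θ → R₁ < φ θ := fun θ hθ hαθ ↦ by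
    by_contra h
    exact (le_csSup hSc.bddAbove ⟨hθ, not_lt.1 h⟩).not_gt hαθ
  have hαb : α < b := lt_of_le_of_ne hαab.2 fun h ↦ by
    have := hαS.2
    rw [mem_preimage, h, mem_Iic] at this
    linarith
  have hφα : φ α = R₁ := by
    refine le_antisymm hαS.2 ?_
    -- approach `α` from the right
    set x : ℕ → ℝ := fun n ↦ α + (b - α) / (n + 2) with hx
    have hxmem : ∀ n, x n ∈ Icc a b ∧ α < x n := fun n ↦ by
      have h1 : 0 < (b - α) / (n + 2) := by positivity
      have h2 : (b - α) / (n + 2) ≤ b - α := div_le_self (by linarith) (by linarith)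
      exact ⟨⟨by linarith [hαab.1], by simp only [hx]; linarith⟩, by simp only [hx]; linarith⟩
    have hxt : Tendsto x atTop (𝓝[Icc a b] α) := by
      refine tendsto_nhdsWithin_iff.2 ⟨?_, Eventually.of_forall fun n ↦ (hxmem n).1⟩
      have : Tendsto (fun n : ℕ ↦ (b - α) / ((n : ℝ) + 2)) atTop (𝓝 0) :=
        tendsto_const_nhds.div_atTop (tendsto_natCast_atTop_atTop.atTop_add tendsto_const_nhds)
      simpa [hx] using tendsto_const_nhds.add this
    have hlim : Tendsto (fun n ↦ φ (x n)) atTop (𝓝 (φ α)) := (hφ α hαab).tendsto.comp hxt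
    exact ge_of_tendsto' hlim fun n ↦ (hgt _ (hxmem n).1 (hxmem n).2).le
  -- `β`: the first time after `α` with `φ ≥ R₂`
  set T : Set ℝ := Icc α b ∩ φ ⁻¹' Ici R₂ with hT
  have hφ' : ContinuousOn φ (Icc α b) := hφ.mono (Icc_subset_Icc hαab.1 le_rfl)
  have hTc : IsCompact T :=
    isCompact_Icc.of_isClosed_subset (hφ'.preimage_isClosed_of_isClosed isClosed_Icc isClosed_Ici)
      inter_subset_left
  have hbT : b ∈ T := ⟨right_mem_Icc.2 hαb.le, hb.le⟩
  set β := sInf T with hβdef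
  have hβT : β ∈ T := hTc.sInf_mem ⟨b, hbT⟩
  have hβαb : β ∈ Icc α b := hβT.1
  have hlt : ∀ θ ∈ Icc α b, θ < β → φ θ < R₂ := fun θ hθ hθβ ↦ by
    by_contra h
    exact (csInf_le hTc.bddBelow ⟨hθ, not_lt.1 h⟩).not_gt hθβ
  have hαβ : α < β := lt_of_le_of_ne hβαb.1 fun h ↦ by
    have := hβT.2
    rw [mem_preimage, ← h, hφα, mem_Ici] at this
    linarith
  have hφβ : φ β = R₂ := by
    refine le_antisymm ?_ hβT.2
    set y : ℕ → ℝ := fun n ↦ β - (β - α) / (n + 2) with hy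
    have hymem : ∀ n, y n ∈ Icc α b ∧ y n < β := fun n ↦ by
      have h1 : 0 < (β - α) / (n + 2) := by positivity
      have h2 : (β - α) / (n + 2) ≤ β - α := div_le_self (by linarith) (by linarith)
      exact ⟨⟨by simp only [hy]; linarith, by simp only [hy]; linarith [hβαb.2]⟩,
        by simp only [hy]; linarith⟩
    have hyt : Tendsto y atTop (𝓝[Icc a b] β) := by
      refine tendsto_nhdsWithin_iff.2 ⟨?_, Eventually.of_forall fun n ↦
        Icc_subset_Icc hαab.1 le_rfl (hymem n).1⟩
      have : Tendsto (fun n : ℕ ↦ (β - α) / ((n : ℝ) + 2)) atTop (𝓝 0) :=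
        tendsto_const_nhds.div_atTop (tendsto_natCast_atTop_atTop.atTop_add tendsto_const_nhds)
      simpa [hy] using tendsto_const_nhds.sub this
    have hlim : Tendsto (fun n ↦ φ (y n)) atTop (𝓝 (φ β)) :=
      (hφ β (Icc_subset_Icc hαab.1 le_rfl hβαb)).tendsto.comp hyt
    exact le_of_tendsto' hlim fun n ↦ (hlt _ (hymem n).1 (hymem n).2).le
  refine ⟨α, β, hαab.1, hαβ, hβαb.2, hφα, hφβ, fun θ hθ ↦ ⟨?_, ?_⟩⟩
  · exact hgt θ ⟨hαab.1.trans hθ.1.le, hθ.2.le.trans hβαb.2⟩ hθ.1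
  · exact hlt θ ⟨hθ.1.le, hθ.2.le.trans hβαb.2⟩ hθ.2

/-- A crossing in either direction: if `φ` is continuous on `[a, b]` and takes a value `< R₁` at
`s` and a value `> R₂` at `t` (`R₁ < R₂`; `s, t ∈ [a, b]`), there is a subinterval `[α, β]` on
whose interior `R₁ < φ < R₂` and whose endpoint values are `R₁` and `R₂` in some order.
[folklore] -/
theorem exists_Ioo_crossing {φ : ℝ → ℝ} {a b R₁ R₂ s t : ℝ} (hφ : ContinuousOn φ (Icc a b))
    (hs : s ∈ Icc a b) (ht : t ∈ Icc a b) (hφs : φ s < R₁) (hφt : R₂ < φ t) (hR : R₁ < R₂) :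
    ∃ α β, a ≤ α ∧ α < β ∧ β ≤ b ∧ (∀ θ ∈ Ioo α β, R₁ < φ θ ∧ φ θ < R₂) ∧
      (φ α = R₁ ∧ φ β = R₂ ∨ φ α = R₂ ∧ φ β = R₁) := by
  rcases lt_or_ge s t with hst | hts
  · obtain ⟨α, β, hα, hαβ, hβ, h1, h2, h3⟩ := exists_Ioo_crossing_of_lt hst.le
      (hφ.mono (Icc_subset_Icc hs.1 ht.2)) hφs hφt hR
    exact ⟨α, β, hs.1.trans hα, hαβ, hβ.trans ht.2, h3, Or.inl ⟨h1, h2⟩⟩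
  · -- reverse the parametrisation
    have hψ : ContinuousOn (fun θ ↦ φ (-θ)) (Icc (-s) (-t)) := by
      refine hφ.comp continuous_neg.continuousOn fun θ hθ ↦ ?_
      exact ⟨by linarith [ht.1, hθ.2], by linarith [hs.2, hθ.1]⟩
    obtain ⟨α, β, hα, hαβ, hβ, h1, h2, h3⟩ := exists_Ioo_crossing_of_lt (φ := fun θ ↦ φ (-θ))
      (neg_le_neg hts) hψ (by simpa using hφs) (by simpa using hφt) hR
    refine ⟨-β, -α, by linarith [ht.1], by linarith, by linarith [hs.2], fun θ hθ ↦ ?_,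
      Or.inr ⟨by simpa using h2, by simpa using h1⟩⟩
    have := h3 (-θ) ⟨by linarith [hθ.2], by linarith [hθ.1]⟩
    simpa using this

/-! ### A crossing semicircle has `ρ`-length at least `log (R₂ / R₁)` -/

/-- The derivative of `log ‖F‖` along a differentiable curve `F : ℝ → ℂ` avoiding `0` is
bounded by `‖F'‖ / ‖F‖`. [folklore] -/
theorem exists_hasDerivAt_log_norm {F : ℝ → ℂ} {F' : ℂ} {θ : ℝ} (hF : HasDerivAt F F' θ)
    (h0 : F θ ≠ 0) :
    ∃ d : ℝ, HasDerivAt (fun θ ↦ Real.log ‖F θ‖) d θ ∧ |d| ≤ ‖F'‖ / ‖F θ‖ := by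
  have h1 : HasDerivAt (fun θ ↦ ‖F θ‖ ^ 2) (2 * inner ℝ (F θ) F') θ := hF.norm_sq
  have hn : ‖F θ‖ ≠ 0 := norm_ne_zero_iff.2 h0
  have hn2 : ‖F θ‖ ^ 2 ≠ 0 := pow_ne_zero 2 hn
  have h2 : HasDerivAt (fun θ ↦ Real.log (‖F θ‖ ^ 2)) ((2 * inner ℝ (F θ) F') / ‖F θ‖ ^ 2) θ :=
    h1.log hn2
  have h3 : HasDerivAt (fun θ ↦ (1 / 2 : ℝ) * Real.log (‖F θ‖ ^ 2))
      ((1 / 2 : ℝ) * ((2 * inner ℝ (F θ) F') / ‖F θ‖ ^ 2)) θ := h2.const_mul _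
  refine ⟨(1 / 2 : ℝ) * ((2 * inner ℝ (F θ) F') / ‖F θ‖ ^ 2), ?_, ?_⟩
  · refine h3.congr_of_eventuallyEq ?_
    filter_upwards [hF.continuousAt.eventually_ne h0] with x hx
    rw [Real.log_pow, Nat.cast_ofNat]
    ring
  · have hcs : |inner ℝ (F θ) F'| ≤ ‖F θ‖ * ‖F'‖ := abs_real_inner_le_norm _ _
    have hpos : 0 < ‖F θ‖ := norm_pos_iff.2 h0
    rw [show (1 / 2 : ℝ) * ((2 * inner ℝ (F θ) F') / ‖F θ‖ ^ 2) = inner ℝ (F θ) F' / ‖F θ‖ ^ 2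
      by field_simp, abs_div, abs_of_pos (by positivity : 0 < ‖F θ‖ ^ 2),
      div_le_div_iff₀ (by positivity) hpos]
    nlinarith

/-- **A semicircle whose image crosses the annulus has `ρ`-length at least `log (R₂/R₁)`**:
if `f` is holomorphic on `ℍ`, `u > 0`, and the image of the upper semicircle of radius `u`
about `c` has a point of modulus `< R₁` and a point of modulus `> R₂`, then
`log (R₂/R₁) ≤ u ∫_0^π ρ(c + u e^{iθ}) dθ` for `ρ = |f'|/|f| · 1{R₁ < |f| < R₂}` (fundamental
theorem of calculus for `log |f(c + u e^{iθ})|` on a subarc along which `R₁ < |f| < R₂`).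
[folklore] -/
theorem ofReal_log_le_mul_logAngLen (hf : DifferentiableOn ℂ f upperHalfPlaneSet) {c u : ℝ}
    (hu : 0 < u) (hR₁ : 0 < R₁) (hR : R₁ < R₂) {θ' θ'' : ℝ} (hθ' : θ' ∈ Ioo 0 π)
    (hθ'' : θ'' ∈ Ioo 0 π) (h₁ : ‖f (circleMap (c : ℂ) u θ')‖ < R₁) (h₂ : R₂ < ‖f (circleMap (c : ℂ) u θ'')‖) :
    ENNReal.ofReal (Real.log (R₂ / R₁)) ≤ ENNReal.ofReal u * logAngLen f R₁ R₂ c u := by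
  -- the curve and its derivative
  set F : ℝ → ℂ := fun θ ↦ f (circleMap (c : ℂ) u θ) with hFdef
  set F' : ℝ → ℂ := fun θ ↦ deriv f (circleMap (c : ℂ) u θ) * (circleMap 0 u θ * I) with hF'def
  have hmem : ∀ θ ∈ Ioo (0 : ℝ) π, circleMap (c : ℂ) u θ ∈ upperHalfPlaneSet := fun θ hθ ↦ circleMap_mem_upperHalfPlaneSet c hu hθ
  have hFd : ∀ θ ∈ Ioo (0 : ℝ) π, HasDerivAt F (F' θ) θ := fun θ hθ ↦ by
    have hfd : HasDerivAt f (deriv f (circleMap (c : ℂ) u θ)) (circleMap (c : ℂ) u θ) :=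
      (hf.differentiableAt (isOpen_upperHalfPlaneSet.mem_nhds (hmem θ hθ))).hasDerivAt
    exact hfd.comp θ (hasDerivAt_circleMap (c : ℂ) u θ)
  have hFc : ContinuousOn F (Icc (min θ' θ'') (max θ' θ'')) := by
    have hsub : Icc (min θ' θ'') (max θ' θ'') ⊆ Ioo 0 π := fun θ hθ ↦
      ⟨(lt_min hθ'.1 hθ''.1).trans_le hθ.1, hθ.2.trans_lt (max_lt hθ'.2 hθ''.2)⟩
    exact fun θ hθ ↦ (hFd θ (hsub hθ)).continuousAt.continuousWithinAt
  -- the crossing subarc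
  obtain ⟨α, β, hα, hαβ, hβ, hin, hends⟩ := exists_Ioo_crossing (φ := fun θ ↦ ‖F θ‖) hFc.norm
    (s := θ') (t := θ'') ⟨min_le_left _ _, le_max_left _ _⟩ ⟨min_le_right _ _, le_max_right _ _⟩
    h₁ h₂ hR
  have hIsub : Icc α β ⊆ Ioo 0 π := fun θ hθ ↦
    ⟨(lt_min hθ'.1 hθ''.1).trans_le (hα.trans hθ.1), (hθ.2.trans hβ).trans_lt (max_lt hθ'.2 hθ''.2)⟩
  -- `‖F‖ ∈ [R₁, R₂]` on `[α, β]`, in particular `F ≠ 0`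
  have hbounds : ∀ θ ∈ Icc α β, R₁ ≤ ‖F θ‖ ∧ ‖F θ‖ ≤ R₂ := fun θ hθ ↦ by
    rcases eq_or_lt_of_le hθ.1 with h | h
    · subst h
      rcases hends with ⟨h1, -⟩ | ⟨h1, -⟩ <;> rw [h1] <;> constructor <;> linarith
    rcases eq_or_lt_of_le hθ.2 with h' | h'
    · subst h'
      rcases hends with ⟨-, h1⟩ | ⟨-, h1⟩ <;> rw [h1] <;> constructor <;> linarith
    exact ⟨(hin θ ⟨h, h'⟩).1.le, (hin θ ⟨h, h'⟩).2.le⟩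
  have hF0 : ∀ θ ∈ Icc α β, F θ ≠ 0 := fun θ hθ ↦
    norm_pos_iff.1 (hR₁.trans_le (hbounds θ hθ).1)
  -- the derivative of `log ‖F‖` and its bound
  have hD : ∀ θ ∈ Icc α β, ∃ d : ℝ, HasDerivAt (fun θ ↦ Real.log ‖F θ‖) d θ ∧
      |d| ≤ ‖F' θ‖ / ‖F θ‖ := fun θ hθ ↦
    exists_hasDerivAt_log_norm (hFd θ (hIsub hθ)) (hF0 θ hθ)
  choose! d hd hdle using hD
  -- continuity of `F`, `F'` on `(0, π)` and of `g = ‖F'‖ / ‖F‖` where `F ≠ 0`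
  have hderivc : ContinuousOn (deriv f) upperHalfPlaneSet :=
    (hf.contDiffOn isOpen_upperHalfPlaneSet).continuousOn_deriv_of_isOpen isOpen_upperHalfPlaneSet
      le_rfl
  have hFcI : ContinuousOn F (Ioo 0 π) := fun θ hθ ↦ (hFd θ hθ).continuousAt.continuousWithinAt
  have hF'cI : ContinuousOn F' (Ioo 0 π) := by
    refine ContinuousOn.mul ?_ (Continuous.continuousOn (by fun_prop))
    exact hderivc.comp (continuous_circleMap (c : ℂ) u).continuousOn fun θ hθ ↦ hmem θ hθ
  set U : Set ℝ := {θ ∈ Ioo (0 : ℝ) π | F θ ≠ 0} with hUdef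
  have hUopen : IsOpen U := by
    rw [show U = Ioo (0 : ℝ) π ∩ F ⁻¹' {0}ᶜ by rfl]
    exact hFcI.isOpen_inter_preimage isOpen_Ioo isOpen_compl_singleton
  have hIU : Icc α β ⊆ U := fun θ hθ ↦ ⟨hIsub hθ, hF0 θ hθ⟩
  set g : ℝ → ℝ := fun θ ↦ ‖F' θ‖ / ‖F θ‖ with hgdef
  have hgU : ContinuousOn g U :=
    (hF'cI.mono fun θ hθ ↦ hθ.1).norm.div (hFcI.mono fun θ hθ ↦ hθ.1).norm
      fun θ hθ ↦ norm_ne_zero_iff.2 hθ.2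
  have hgc : ContinuousOn g (Icc α β) := hgU.mono hIU
  have hg0 : ∀ θ, 0 ≤ g θ := fun θ ↦ div_nonneg (norm_nonneg _) (norm_nonneg _)
  have hgint : IntervalIntegrable g volume α β := hgc.intervalIntegrable_of_Icc hαβ.le
  -- the primitive of `g` and its derivative at interior points
  have hprim : ∀ x ∈ Ioo α β, HasDerivAt (fun θ ↦ ∫ t in α..θ, g t) (g x) x := fun x hx ↦ by
    have hxU : x ∈ U := hIU (Ioo_subset_Icc_self hx)
    refine intervalIntegral.integral_hasDerivAt_right (hgint.mono_set ?_)
      (hgU.stronglyMeasurableAtFilter hUopen x hxU) (hgU.continuousAt (hUopen.mem_nhds hxU))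
    rw [uIcc_of_le hαβ.le, uIcc_of_le hx.1.le]
    exact Icc_subset_Icc le_rfl hx.2.le
  have hprimc : ContinuousOn (fun θ ↦ ∫ t in α..θ, g t) (Icc α β) := by
    have := intervalIntegral.continuousOn_primitive_interval' hgint (left_mem_uIcc (a := α) (b := β))
    rwa [uIcc_of_le hαβ.le] at this
  have hlogc : ContinuousOn (fun θ ↦ Real.log ‖F θ‖) (Icc α β) :=
    ((hFcI.mono hIsub).norm).log fun θ hθ ↦ norm_ne_zero_iff.2 (hF0 θ hθ)
  -- one-sided bounds by monotonicity of `± log ‖F‖ - ∫ g`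
  have hkey : ∀ σ : ℝ, (σ = 1 ∨ σ = -1) →
      σ * Real.log ‖F β‖ - σ * Real.log ‖F α‖ ≤ ∫ t in α..β, g t := by
    intro σ hσ
    have hσ1 : |σ| = 1 := by rcases hσ with rfl | rfl <;> simp
    set G : ℝ → ℝ := fun θ ↦ σ * Real.log ‖F θ‖ - ∫ t in α..θ, g t with hGdef
    have hGc : ContinuousOn G (Icc α β) := (hlogc.const_smul σ).sub hprimc
    have hGd : ∀ x ∈ Ioo α β, HasDerivAt G (σ * d x - g x) x := fun x hx ↦
      ((hd x (Ioo_subset_Icc_self hx)).const_mul σ).sub (hprim x hx)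
    have hanti : AntitoneOn G (Icc α β) := by
      refine antitoneOn_of_deriv_nonpos (convex_Icc α β) hGc ?_ ?_
      · rw [interior_Icc]
        exact fun x hx ↦ (hGd x hx).differentiableAt.differentiableWithinAt
      · rw [interior_Icc]
        intro x hx
        rw [(hGd x hx).deriv]
        have h1 : σ * d x ≤ |d x| := by
          have := abs_mul σ (d x)
          rw [hσ1, one_mul] at this
          exact (le_abs_self _).trans this.le
        have h2 := hdle x (Ioo_subset_Icc_self hx)
        simp only [hgdef]
        linarith
    have h := hanti (left_mem_Icc.2 hαβ.le) (right_mem_Icc.2 hαβ.le) hαβ.le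
    simp only [hGdef, intervalIntegral.integral_same, sub_zero] at h
    linarith
  have hlog : Real.log (R₂ / R₁) ≤ ∫ t in α..β, g t := by
    rw [Real.log_div (by linarith) hR₁.ne']
    rcases hends with ⟨h1, h2⟩ | ⟨h1, h2⟩
    · have := hkey 1 (Or.inl rfl)
      rw [h1, h2] at this
      linarith
    · have := hkey (-1) (Or.inr rfl)
      rw [h1, h2] at this
      linarith
  -- pass to the `ℝ≥0∞`-valued angular integral
  have hIoo : ∀ θ ∈ Ioo α β, ENNReal.ofReal (g θ) = ENNReal.ofReal u * dens f R₁ R₂ (circleMap (c : ℂ) u θ) := by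
    intro θ hθ
    have hθI : θ ∈ Ioo 0 π := hIsub (Ioo_subset_Icc_self hθ)
    have hpre : circleMap (c : ℂ) u θ ∈ preAnn f R₁ R₂ := ⟨hmem θ hθI, (hin θ hθ).1, (hin θ hθ).2⟩
    have hg : g θ = u * (‖deriv f (circleMap (c : ℂ) u θ)‖ / ‖f (circleMap (c : ℂ) u θ)‖) := by
      show ‖deriv f (circleMap (c : ℂ) u θ) * (circleMap 0 u θ * I)‖ / ‖f (circleMap (c : ℂ) u θ)‖ = _
      rw [norm_mul, norm_circleMap_zero_mul_I, abs_of_pos hu]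
      ring
    rw [dens, indicator_of_mem hpre, ← ENNReal.ofReal_mul hu.le, hg]
  calc ENNReal.ofReal (Real.log (R₂ / R₁))
      ≤ ENNReal.ofReal (∫ t in α..β, g t) := ENNReal.ofReal_le_ofReal hlog
    _ = ∫⁻ t in Ioc α β, ENNReal.ofReal (g t) := by
        rw [intervalIntegral.integral_of_le hαβ.le, ofReal_integral_eq_lintegral_ofReal]
        · exact (hgc.integrableOn_Icc (μ := volume)).mono_set Ioc_subset_Icc_self
        · exact Eventually.of_forall fun θ ↦ hg0 θ
    _ = ∫⁻ t in Ioo α β, ENNReal.ofReal (g t) := setLIntegral_congr Ioo_ae_eq_Ioc.symm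
    _ = ∫⁻ t in Ioo α β, ENNReal.ofReal u * dens f R₁ R₂ (circleMap (c : ℂ) u t) :=
        setLIntegral_congr_fun measurableSet_Ioo hIoo
    _ = ENNReal.ofReal u * ∫⁻ t in Ioo α β, dens f R₁ R₂ (circleMap (c : ℂ) u t) :=
        lintegral_const_mul' _ _ ENNReal.ofReal_ne_top
    _ ≤ ENNReal.ofReal u * logAngLen f R₁ R₂ c u := by
        gcongr
        exact lintegral_mono_set (Ioo_subset_Ioo (le_of_lt ((lt_min hθ'.1 hθ''.1).trans_le hα))
          ((hβ.trans_lt (max_lt hθ'.2 hθ''.2)).le))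

/-! ### The `ρ`-area of `ℍ` is at most the logarithmic area of the annulus -/

/-- `∫_a^b dr / r = log (b / a)` as a Lebesgue integral over `(a, b)`, `0 < a ≤ b`. [folklore] -/
theorem lintegral_inv_Ioo {a b : ℝ} (ha : 0 < a) (hab : a ≤ b) :
    ∫⁻ r in Ioo a b, ENNReal.ofReal r⁻¹ = ENNReal.ofReal (Real.log (b / a)) := by
  have hcont : ContinuousOn (fun r : ℝ ↦ r⁻¹) (Icc a b) :=
    continuousOn_inv₀.mono fun r hr ↦ (ha.trans_le hr.1).ne'
  have hint : IntegrableOn (fun r : ℝ ↦ r⁻¹) (Ioc a b) :=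
    (hcont.integrableOn_Icc (μ := volume)).mono_set Ioc_subset_Icc_self
  rw [setLIntegral_congr Ioo_ae_eq_Ioc, ← ofReal_integral_eq_lintegral_ofReal hint,
    ← intervalIntegral.integral_of_le hab, integral_inv_of_pos ha (ha.trans_le hab)]
  filter_upwards [ae_restrict_mem measurableSet_Ioc] with r hr
  exact inv_nonneg.2 (ha.trans hr.1).le

/-- The logarithmic area of the annulus: `∫∫_{R₁ < |z| < R₂} |dz|² / |z|² = 2π log (R₂/R₁)`.
[folklore] -/
theorem lintegral_annulus_inv_sq (hR₁ : 0 < R₁) (hR : R₁ ≤ R₂) :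
    ∫⁻ z in {z : ℂ | R₁ < ‖z‖ ∧ ‖z‖ < R₂}, ENNReal.ofReal (‖z‖ ^ 2)⁻¹ =
      ENNReal.ofReal (2 * π) * ENNReal.ofReal (Real.log (R₂ / R₁)) := by
  have hmeas : MeasurableSet {z : ℂ | R₁ < ‖z‖ ∧ ‖z‖ < R₂} :=
    (isOpen_Ioo.preimage continuous_norm).measurableSet
  rw [← lintegral_indicator hmeas, ← Complex.lintegral_comp_polarCoord_symm,
    LengthArea.lintegral_polarCoord_target_eq]
  · have hinner : ∀ r ∈ Ioi (0 : ℝ), ∫⁻ t in Ioo (-π) π, ENNReal.ofReal ((r, t) : ℝ × ℝ).1 •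
        ({z : ℂ | R₁ < ‖z‖ ∧ ‖z‖ < R₂}.indicator (fun z ↦ ENNReal.ofReal (‖z‖ ^ 2)⁻¹))
          (Complex.polarCoord.symm (r, t)) =
        ENNReal.ofReal (2 * π) * (Ioo R₁ R₂).indicator (fun r ↦ ENNReal.ofReal r⁻¹) r := by
      intro r hr
      have hr0 : 0 < r := hr
      have hnorm : ∀ t : ℝ, ‖Complex.polarCoord.symm (r, t)‖ = r := fun t ↦ by
        rw [Complex.norm_polarCoord_symm, abs_of_pos hr0]
      have hval : ∀ t : ℝ, ENNReal.ofReal ((r, t) : ℝ × ℝ).1 •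
          ({z : ℂ | R₁ < ‖z‖ ∧ ‖z‖ < R₂}.indicator (fun z ↦ ENNReal.ofReal (‖z‖ ^ 2)⁻¹))
            (Complex.polarCoord.symm (r, t)) =
          (Ioo R₁ R₂).indicator (fun r ↦ ENNReal.ofReal r⁻¹) r := by
        intro t
        simp only [smul_eq_mul, indicator, mem_setOf_eq, hnorm t, mem_Ioo]
        split_ifs with h
        · rw [← ENNReal.ofReal_mul hr0.le]
          congr 1
          field_simp
        · rw [mul_zero]
      simp_rw [hval]
      rw [setLIntegral_const, Real.volume_Ioo, mul_comm]
      congr 1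
      congr 1
      ring
    rw [setLIntegral_congr_fun measurableSet_Ioi hinner, lintegral_const_mul' _ _ ENNReal.ofReal_ne_top,
      lintegral_indicator measurableSet_Ioo, Measure.restrict_restrict measurableSet_Ioo,
      show Ioo R₁ R₂ ∩ Ioi 0 = Ioo R₁ R₂ from
        inter_eq_left.2 fun r hr ↦ (hR₁.trans hr.1 : (0 : ℝ) < r),
      lintegral_inv_Ioo hR₁ hR]
  · refine Measurable.mul (measurable_fst.ennreal_ofReal) ?_
    have hps : Measurable (Complex.polarCoord.symm : ℝ × ℝ → ℂ) := by
      have h : (Complex.polarCoord.symm : ℝ × ℝ → ℂ) = fun p ↦ (p.1 : ℂ) * exp (p.2 * I) :=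
        funext LengthArea.polarCoord_symm_eq
      rw [h]
      exact Continuous.measurable (by fun_prop)
    exact ((measurable_norm.pow_const 2).inv.ennreal_ofReal.indicator hmeas).comp hps

/-- **Area bound**: the `ρ²`-area of `ℍ` is at most `2π log (R₂/R₁)`, by the area formula for
the injective differentiable map `f` on `{w ∈ ℍ : R₁ < |f w| < R₂}` (Jacobian `|f'|²`) and the
logarithmic area of the annulus. [cite: PommerenkeBBCM1992, Prop. 2.2] -/
theorem lintegral_densSq_le (hf : DifferentiableOn ℂ f upperHalfPlaneSet)
    (hinj : InjOn f upperHalfPlaneSet) (hR₁ : 0 < R₁) (hR : R₁ ≤ R₂) :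
    ∫⁻ w, densSq f R₁ R₂ w ≤ ENNReal.ofReal (2 * π) * ENNReal.ofReal (Real.log (R₂ / R₁)) := by
  have hsub : preAnn f R₁ R₂ ⊆ upperHalfPlaneSet := fun w hw ↦ hw.1
  have hmeas : MeasurableSet (preAnn f R₁ R₂) := measurableSet_preAnn hf.continuousOn R₁ R₂
  have hd : ∀ w ∈ preAnn f R₁ R₂, HasFDerivWithinAt f
      ((ContinuousLinearMap.smulRight (1 : ℂ →L[ℂ] ℂ) (deriv f w)).restrictScalars ℝ)
      (preAnn f R₁ R₂) w := fun w hw ↦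
    ((hf.differentiableAt (isOpen_upperHalfPlaneSet.mem_nhds (hsub hw))).hasDerivAt.hasFDerivAt
      |>.restrictScalars ℝ).hasFDerivWithinAt
  set G : ℂ → ℝ≥0∞ := fun z ↦ ENNReal.ofReal (‖z‖ ^ 2)⁻¹ with hG
  have hcv := lintegral_image_eq_lintegral_abs_det_fderiv_mul volume hmeas hd (hinj.mono hsub) G
  have hrhs : ∫⁻ w in preAnn f R₁ R₂, ENNReal.ofReal |((ContinuousLinearMap.smulRight
      (1 : ℂ →L[ℂ] ℂ) (deriv f w)).restrictScalars ℝ).det| * G (f w) =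
      ∫⁻ w, densSq f R₁ R₂ w := by
    rw [densSq, lintegral_indicator hmeas]
    refine setLIntegral_congr_fun hmeas fun w hw ↦ ?_
    rw [LengthArea.det_restrictScalars_smulRight, abs_of_nonneg (by positivity), hG,
      ← ENNReal.ofReal_mul (by positivity)]
    congr 1
    rw [div_pow, div_eq_mul_inv]
  rw [← hrhs, ← hcv, ← lintegral_annulus_inv_sq hR₁ hR]
  refine lintegral_mono_set ?_
  rintro _ ⟨w, hw, rfl⟩
  exact hw.2

/-! ### Fubini in polar coordinates about the centre `c` -/

/-- `∫_{u > 0} u ∫_0^π ρ(c + u e^{iθ})² dθ du ≤ ∫∫_ℍ ρ²` (polar coordinates about the real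
point `c`, keeping only the upper half of each circle). [folklore] -/
theorem lintegral_mul_logAngSq_le (hfc : ContinuousOn f upperHalfPlaneSet) (R₁ R₂ c : ℝ) :
    ∫⁻ u in Ioi 0, ENNReal.ofReal u * logAngSq f R₁ R₂ c u ≤ ∫⁻ w, densSq f R₁ R₂ w := by
  have hF : Measurable fun q : ℝ × ℝ ↦ ENNReal.ofReal q.1 * densSq f R₁ R₂ (circleMap (c : ℂ) q.1 q.2) :=
    measurable_fst.ennreal_ofReal.mul
      ((measurable_densSq hfc R₁ R₂).comp (continuous_circleMap_uncurry (c : ℂ)).measurable)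
  rw [← lintegral_add_left_eq_self (μ := volume) (densSq f R₁ R₂) (c : ℂ),
    ← Complex.lintegral_comp_polarCoord_symm]
  simp_rw [smul_eq_mul, add_polarCoord_symm]
  rw [LengthArea.lintegral_polarCoord_target_eq hF]
  refine setLIntegral_mono' measurableSet_Ioi fun u _ ↦ ?_
  rw [logAngSq, ← lintegral_const_mul' _ _ ENNReal.ofReal_ne_top]
  exact lintegral_mono_set (Ioo_subset_Ioo (by linarith [Real.pi_pos]) le_rfl)

/-! ### The length–area inequality for one family of semicircles -/

/-- **Length–area for concentric semicircles crossing an annulus.** Let `f` be holomorphic and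
injective on `ℍ` (and measurable on `ℂ`), `0 < R₁ < R₂`, and let `S ⊆ (0, ∞)` be a measurable
set of radii such that for every `u ∈ S` the image of the upper semicircle of radius `u` about
the real point `c` contains a point of modulus `< R₁` and a point of modulus `> R₂`. Then
`∫_S du / u ≤ 2π² / log (R₂/R₁)`. (Each such semicircle has `ρ`-length `≥ L = log (R₂/R₁)`;
by Cauchy–Schwarz `L²/u ≤ π u ∫ ρ²`; integrating in `u` and using polar coordinates about `c`,
`L² ∫_S du/u ≤ π ∫∫ ρ² ≤ 2π² L`.) This is the comparison "extremal length of the semicircle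
family ≥ extremal distance of the annulus boundaries" of the length–area method.
[cite: PommerenkeBBCM1992, Prop. 2.2] -/
theorem lintegral_inv_le_of_forall_crossing (hf : DifferentiableOn ℂ f upperHalfPlaneSet) (hinj : InjOn f upperHalfPlaneSet)
    (hR₁ : 0 < R₁) (hR : R₁ < R₂) {c : ℝ} {S : Set ℝ} (hSm : MeasurableSet S) (hS0 : S ⊆ Ioi 0)
    (hcross : ∀ u ∈ S, ∃ θ' ∈ Ioo (0 : ℝ) π, ∃ θ'' ∈ Ioo (0 : ℝ) π,
      ‖f (circleMap (c : ℂ) u θ')‖ < R₁ ∧ R₂ < ‖f (circleMap (c : ℂ) u θ'')‖) :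
    ∫⁻ u in S, ENNReal.ofReal u⁻¹ ≤ ENNReal.ofReal (2 * π ^ 2 / Real.log (R₂ / R₁)) := by
  set L : ℝ := Real.log (R₂ / R₁) with hL
  have hLpos : 0 < L := Real.log_pos ((one_lt_div hR₁).2 hR)
  have hfc : ContinuousOn f upperHalfPlaneSet := hf.continuousOn
  -- pointwise: `L² / u ≤ π u ∫ ρ²`
  have hpt : ∀ u ∈ S, ENNReal.ofReal (L ^ 2) * ENNReal.ofReal u⁻¹ ≤
      ENNReal.ofReal π * (ENNReal.ofReal u * logAngSq f R₁ R₂ c u) := by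
    intro u hu
    have hu0 : 0 < u := hS0 hu
    obtain ⟨θ', hθ', θ'', hθ'', h1, h2⟩ := hcross u hu
    have hlen := ofReal_log_le_mul_logAngLen hf hu0 hR₁ hR hθ' hθ'' h1 h2
    have h3 := LengthArea.ofReal_sq_div_le hu0 hLpos.le hlen
    rw [← ENNReal.ofReal_mul (sq_nonneg L), ← div_eq_mul_inv]
    refine h3.trans ?_
    rw [mul_left_comm]
    exact mul_le_mul_right (logAngLen_sq_le hfc R₁ R₂ c u) _
  -- integrate over `S`
  have hint : ENNReal.ofReal (L ^ 2) * ∫⁻ u in S, ENNReal.ofReal u⁻¹ ≤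
      ENNReal.ofReal π * (ENNReal.ofReal (2 * π) * ENNReal.ofReal L) := by
    calc ENNReal.ofReal (L ^ 2) * ∫⁻ u in S, ENNReal.ofReal u⁻¹
        = ∫⁻ u in S, ENNReal.ofReal (L ^ 2) * ENNReal.ofReal u⁻¹ :=
          (lintegral_const_mul _ measurable_inv.ennreal_ofReal).symm
      _ ≤ ∫⁻ u in S, ENNReal.ofReal π * (ENNReal.ofReal u * logAngSq f R₁ R₂ c u) :=
          setLIntegral_mono' hSm hpt
      _ = ENNReal.ofReal π * ∫⁻ u in S, ENNReal.ofReal u * logAngSq f R₁ R₂ c u :=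
          lintegral_const_mul' _ _ ENNReal.ofReal_ne_top
      _ ≤ ENNReal.ofReal π * ∫⁻ u in Ioi 0, ENNReal.ofReal u * logAngSq f R₁ R₂ c u :=
          mul_le_mul_right (lintegral_mono_set hS0) _
      _ ≤ ENNReal.ofReal π * ∫⁻ w, densSq f R₁ R₂ w :=
          mul_le_mul_right (lintegral_mul_logAngSq_le hfc R₁ R₂ c) _
      _ ≤ ENNReal.ofReal π * (ENNReal.ofReal (2 * π) * ENNReal.ofReal L) :=
          mul_le_mul_right (lintegral_densSq_le hf hinj hR₁ hR.le) _
  -- divide by `L²`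
  have hL2 : ENNReal.ofReal (L ^ 2) ≠ 0 := by positivity
  rw [← ENNReal.ofReal_mul (by positivity : (0 : ℝ) ≤ 2 * π),
    ← ENNReal.ofReal_mul Real.pi_pos.le] at hint
  have : ∫⁻ u in S, ENNReal.ofReal u⁻¹ ≤
      ENNReal.ofReal (π * (2 * π * L)) / ENNReal.ofReal (L ^ 2) := by
    rw [ENNReal.le_div_iff_mul_le (Or.inl hL2) (Or.inl ENNReal.ofReal_ne_top), mul_comm]
    exact hint
  refine this.trans_eq ?_
  rw [← ENNReal.ofReal_div_of_pos (by positivity)]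
  congr 1
  field_simp

/-! ### Two families: circles about `p` and circles about `0` -/

/-- The radii `u > 0` for which the image of the upper semicircle of radius `u` about `c` has a
point of modulus `< R` and a point of modulus `> R'` form an open set (`f` continuous on `ℍ`).
[folklore] -/
theorem isOpen_setOf_crossing (hfc : ContinuousOn f upperHalfPlaneSet) (c R R' : ℝ) :
    IsOpen {u : ℝ | 0 < u ∧ ∃ θ' ∈ Ioo (0 : ℝ) π, ∃ θ'' ∈ Ioo (0 : ℝ) π,
      ‖f (circleMap (c : ℂ) u θ')‖ < R ∧ R' < ‖f (circleMap (c : ℂ) u θ'')‖} := by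
  have hg : ∀ θ ∈ Ioo (0 : ℝ) π, ContinuousOn (fun u ↦ ‖f (circleMap (c : ℂ) u θ)‖) (Ioi 0) := fun θ hθ ↦
    (hfc.comp (continuous_circleMap_left (c : ℂ) θ).continuousOn fun u hu ↦ circleMap_mem_upperHalfPlaneSet c hu hθ).norm
  have h1 : ∀ θ ∈ Ioo (0 : ℝ) π, IsOpen (Ioi 0 ∩ (fun u ↦ ‖f (circleMap (c : ℂ) u θ)‖) ⁻¹' Iio R) :=
    fun θ hθ ↦ (hg θ hθ).isOpen_inter_preimage isOpen_Ioi isOpen_Iio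
  have h2 : ∀ θ ∈ Ioo (0 : ℝ) π, IsOpen (Ioi 0 ∩ (fun u ↦ ‖f (circleMap (c : ℂ) u θ)‖) ⁻¹' Ioi R') :=
    fun θ hθ ↦ (hg θ hθ).isOpen_inter_preimage isOpen_Ioi isOpen_Ioi
  have heq : {u : ℝ | 0 < u ∧ ∃ θ' ∈ Ioo (0 : ℝ) π, ∃ θ'' ∈ Ioo (0 : ℝ) π,
      ‖f (circleMap (c : ℂ) u θ')‖ < R ∧ R' < ‖f (circleMap (c : ℂ) u θ'')‖} =
      (⋃ θ ∈ Ioo (0 : ℝ) π, Ioi 0 ∩ (fun u ↦ ‖f (circleMap (c : ℂ) u θ)‖) ⁻¹' Iio R) ∩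
        ⋃ θ ∈ Ioo (0 : ℝ) π, Ioi 0 ∩ (fun u ↦ ‖f (circleMap (c : ℂ) u θ)‖) ⁻¹' Ioi R' := by
    ext u
    simp only [mem_setOf_eq, mem_inter_iff, mem_iUnion, mem_Ioi, mem_preimage, mem_Iio,
      exists_prop]
    constructor
    · rintro ⟨hu, θ', hθ', θ'', hθ'', h1, h2⟩
      exact ⟨⟨θ', hθ', hu, h1⟩, ⟨θ'', hθ'', hu, h2⟩⟩
    · rintro ⟨⟨θ', hθ', hu, h1⟩, ⟨θ'', hθ'', -, h2⟩⟩
      exact ⟨hu, θ', hθ', θ'', hθ'', h1, h2⟩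
  rw [heq]
  exact (isOpen_biUnion h1).inter (isOpen_biUnion h2)

/-- **Two families of semicircles.** Let `f` be holomorphic and injective on `ℍ` (measurable on
`ℂ`), `0 < m < p`, `L > 0`, and `0 < R₁ < R₂`, `0 < R₃ < R₄` with `L ≤ log (R₂/R₁)`,
`L ≤ log (R₄/R₃)`. Suppose that for every `u ∈ (m/2, m)` either the image of the upper
semicircle of radius `u` about `p` contains points of modulus `< R₁` and `> R₂`, or the image of
the upper semicircle of radius `p - u` about `0` contains points of modulus `< R₃` and `> R₄`.
Then `L · log 2 · m ≤ 2π² (m + 2p)`. (Apply `lintegral_inv_le_of_forall_crossing` to the radii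
of the first kind and, after the substitution `s = p - u` with `du/u ≤ (2p/m) ds/s`, to those of
the second kind; the two sets cover `(m/2, m)`, of logarithmic measure `log 2`.) In the proof of
[LSW] Lemma 6.2 this bounds the size `m` of the image `Ã` of the hull relative to its distance
`p` from the image `W` of the tip. [cite: LawlerSchrammWerner2003Restriction, proof of Lemma 6.2 (extremal length)] -/
theorem mul_log_le_of_forall_crossing_or (hf : DifferentiableOn ℂ f upperHalfPlaneSet) (hinj : InjOn f upperHalfPlaneSet)
    {R₁ R₂ R₃ R₄ L p m : ℝ} (hR₁ : 0 < R₁) (hR₁₂ : R₁ < R₂) (hR₃ : 0 < R₃) (hR₃₄ : R₃ < R₄)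
    (hL : 0 < L) (hL₁ : L ≤ Real.log (R₂ / R₁)) (hL₂ : L ≤ Real.log (R₄ / R₃)) (hm : 0 < m)
    (hmp : m < p)
    (hcross : ∀ u ∈ Ioo (m / 2) m,
      (∃ θ' ∈ Ioo (0 : ℝ) π, ∃ θ'' ∈ Ioo (0 : ℝ) π,
        ‖f (circleMap (p : ℂ) u θ')‖ < R₁ ∧ R₂ < ‖f (circleMap (p : ℂ) u θ'')‖) ∨
      (∃ θ' ∈ Ioo (0 : ℝ) π, ∃ θ'' ∈ Ioo (0 : ℝ) π,
        ‖f (circleMap 0 (p - u) θ')‖ < R₃ ∧ R₄ < ‖f (circleMap 0 (p - u) θ'')‖)) :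
    L * Real.log 2 * m ≤ 2 * π ^ 2 * (m + 2 * p) := by
  have hfc : ContinuousOn f upperHalfPlaneSet := hf.continuousOn
  have hp : 0 < p := hm.trans hmp
  -- the radii of the first kind
  set S₁ : Set ℝ := {u : ℝ | 0 < u ∧ ∃ θ' ∈ Ioo (0 : ℝ) π, ∃ θ'' ∈ Ioo (0 : ℝ) π,
      ‖f (circleMap (p : ℂ) u θ')‖ < R₁ ∧ R₂ < ‖f (circleMap (p : ℂ) u θ'')‖} ∩ Ioo (m / 2) m with hS₁
  have hS₁m : MeasurableSet S₁ :=
    (isOpen_setOf_crossing hfc p R₁ R₂).measurableSet.inter measurableSet_Ioo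
  have hS₁0 : S₁ ⊆ Ioi 0 := fun u hu ↦ hu.1.1
  have hI₁ : ∫⁻ u in S₁, ENNReal.ofReal u⁻¹ ≤ ENNReal.ofReal (2 * π ^ 2 / L) :=
    (lintegral_inv_le_of_forall_crossing hf hinj hR₁ hR₁₂ hS₁m hS₁0
      fun u hu ↦ hu.1.2).trans
      (ENNReal.ofReal_le_ofReal (div_le_div_of_nonneg_left (by positivity) hL hL₁))
  -- the radii of the second kind, and their reflections `s = p - u`
  set S₂ : Set ℝ := Ioo (m / 2) m \ S₁ with hS₂
  have hS₂m : MeasurableSet S₂ := measurableSet_Ioo.diff hS₁m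
  have hS₂sub : S₂ ⊆ Ioo (m / 2) m := fun u hu ↦ hu.1
  have hcross₂ : ∀ u ∈ S₂, ∃ θ' ∈ Ioo (0 : ℝ) π, ∃ θ'' ∈ Ioo (0 : ℝ) π,
      ‖f (circleMap 0 (p - u) θ')‖ < R₃ ∧ R₄ < ‖f (circleMap 0 (p - u) θ'')‖ := by
    intro u hu
    have hu0 : 0 < u := (half_pos hm).trans hu.1.1
    rcases hcross u hu.1 with h | h
    · exact absurd ⟨⟨hu0, h⟩, hu.1⟩ hu.2
    · exact h
  set e : ℝ ≃ᵐ ℝ := MeasurableEquiv.subLeft p with he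
  have heap : ∀ u, e u = p - u := fun u ↦ rfl
  set T₂ : Set ℝ := e '' S₂ with hT₂
  have hT₂m : MeasurableSet T₂ := e.measurableSet_image.2 hS₂m
  have hT₂0 : T₂ ⊆ Ioi 0 := by
    rintro _ ⟨u, hu, rfl⟩
    rw [heap]
    have := (hS₂sub hu).2
    show 0 < p - u
    linarith
  have hI₂ : ∫⁻ s in T₂, ENNReal.ofReal s⁻¹ ≤ ENNReal.ofReal (2 * π ^ 2 / L) := by
    refine (lintegral_inv_le_of_forall_crossing (c := 0) hf hinj hR₃ hR₃₄ hT₂m hT₂0 ?_).trans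
      (ENNReal.ofReal_le_ofReal (div_le_div_of_nonneg_left (by positivity) hL hL₂))
    rintro _ ⟨u, hu, rfl⟩
    rw [heap]
    exact hcross₂ u hu
  -- `∫_{S₂} du/u ≤ (2p/m) ∫_{T₂} ds/s`
  have hpres : MeasurePreserving e volume volume :=
    Measure.measurePreserving_sub_left (volume : Measure ℝ) p
  have hI₂' : ∫⁻ u in S₂, ENNReal.ofReal u⁻¹ ≤
      ENNReal.ofReal (2 * p / m) * ENNReal.ofReal (2 * π ^ 2 / L) := by
    calc ∫⁻ u in S₂, ENNReal.ofReal u⁻¹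
        ≤ ∫⁻ u in S₂, ENNReal.ofReal (2 * p / m) * ENNReal.ofReal (e u)⁻¹ := by
          refine setLIntegral_mono' hS₂m fun u hu ↦ ?_
          have hu1 := (hS₂sub hu).1
          have hu2 := (hS₂sub hu).2
          have hu0 : 0 < u := (half_pos hm).trans hu1
          have hpu : 0 < p - u := by linarith
          rw [heap, ← ENNReal.ofReal_mul (by positivity)]
          refine ENNReal.ofReal_le_ofReal ?_
          have h1 : u⁻¹ ≤ 2 / m := by
            rw [inv_le_comm₀ hu0 (by positivity), inv_div]
            linarith
          have h3 : 1 ≤ p * (p - u)⁻¹ := by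
            rw [← div_eq_mul_inv, one_le_div hpu]
            linarith
          calc u⁻¹ ≤ 2 / m := h1
            _ = 2 / m * 1 := (mul_one _).symm
            _ ≤ 2 / m * (p * (p - u)⁻¹) := by gcongr
            _ = 2 * p / m * (p - u)⁻¹ := by ring
      _ = ENNReal.ofReal (2 * p / m) * ∫⁻ u in S₂, ENNReal.ofReal (e u)⁻¹ :=
          lintegral_const_mul' _ _ ENNReal.ofReal_ne_top
      _ = ENNReal.ofReal (2 * p / m) * ∫⁻ s in T₂, ENNReal.ofReal s⁻¹ := by
          congr 1
          have h := hpres.setLIntegral_comp_preimage_emb e.measurableEmbedding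
            (fun s ↦ ENNReal.ofReal s⁻¹) T₂
          rw [hT₂, e.injective.preimage_image] at h
          exact h
      _ ≤ ENNReal.ofReal (2 * p / m) * ENNReal.ofReal (2 * π ^ 2 / L) :=
          mul_le_mul_right hI₂ _
  -- the two kinds cover `(m/2, m)`, of logarithmic measure `log 2`
  have hcover : Ioo (m / 2) m ⊆ S₁ ∪ S₂ := fun u hu ↦ by
    by_cases h : u ∈ S₁
    · exact Or.inl h
    · exact Or.inr ⟨hu, h⟩
  have hlog2 : ENNReal.ofReal (Real.log 2) ≤
      ENNReal.ofReal (2 * π ^ 2 / L) + ENNReal.ofReal (2 * p / m) * ENNReal.ofReal (2 * π ^ 2 / L) := by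
    have h1 : ∫⁻ u in Ioo (m / 2) m, ENNReal.ofReal u⁻¹ = ENNReal.ofReal (Real.log 2) := by
      rw [lintegral_inv_Ioo (half_pos hm) (by linarith)]
      congr 2
      field_simp
    rw [← h1]
    calc ∫⁻ u in Ioo (m / 2) m, ENNReal.ofReal u⁻¹
        ≤ ∫⁻ u in S₁ ∪ S₂, ENNReal.ofReal u⁻¹ := lintegral_mono_set hcover
      _ ≤ (∫⁻ u in S₁, ENNReal.ofReal u⁻¹) + ∫⁻ u in S₂, ENNReal.ofReal u⁻¹ :=
          lintegral_union_le _ _ _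
      _ ≤ _ := add_le_add hI₁ hI₂'
  -- back to real numbers
  rw [← ENNReal.ofReal_mul (by positivity), ← ENNReal.ofReal_add (by positivity) (by positivity),
    ENNReal.ofReal_le_ofReal_iff (by positivity)] at hlog2
  have hkey : Real.log 2 ≤ 2 * π ^ 2 / L * (1 + 2 * p / m) := by linarith
  rw [div_mul_eq_mul_div, le_div_iff₀ hL] at hkey
  have h3 : Real.log 2 * L * m ≤ 2 * π ^ 2 * (1 + 2 * p / m) * m :=
    mul_le_mul_of_nonneg_right hkey hm.le
  have h4 : 2 * π ^ 2 * (1 + 2 * p / m) * m = 2 * π ^ 2 * (m + 2 * p) := by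
    field_simp
  linarith [h3, h4]

end AnnulusCrossing

end Literature.Analysis.Complex

end
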